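import Mathlib.RingTheory.Flat.TorsionFree
import Mathlib.RingTheory.Nakayama
import Mathlib.RingTheory.OrzechProperty
import Mathlib.RepresentationTheory.Intertwining
import Literature.NumberTheory.DiophantineGeometry.AVGaloisModule
import Literature.NumberTheory.EllipticCurves.TateModuleFixedPointsProofs
import HarnessLib

/-!
# Tate's lattice step for `V_ℓ A ≅ V_ℓ B` and `ℓ`-adic descent lemmas (proofs for `FaltingsAbelian`, I)

First of two sibling proof files of `Literature.AlgebraicGeometry.Motives.FaltingsAbelian`, whose
named fact `isIsogenous_iff_nonempty_equiv_rationalTateRep A B ℓ` (Faltings, Invent. Math. 73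
(1983), §5, Korollar 2, (i) ⇔ (ii): two abelian varieties over a number field are isogenous iff
`V_ℓ A ≅ V_ℓ B` as Galois modules) is reduced to the named fact `faltings_tate_bijective`
(Korollar 1 = **hodge.S27**) in `Literature.AlgebraicGeometry.Motives.FaltingsAbelianIsogenyProofs`.
The printed proof of Korollar 2 is the one line "the equivalence of (i) and (ii) follows from
Theorem 4" (Cornell–Silverman, Ch. II, §5); the argument meant is Tate's (Invent. Math. 2
(1966), §1): compare the lattices `T_ℓ` inside `V_ℓ` and descend from `ℤ_ℓ ⊗ Hom` to `Hom`.
This file proves its generic inputs: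

* `PadicInt.bijective_id_add_p_smul`: `1 + ℓ u` is bijective on a finitely generated
  `ℤ_ℓ`-module (Nakayama's lemma and Vasconcelos' theorem);
* `PadicInt.isOfFinAddOrder_of_one_tmul_eq_zero`,
  `PadicInt.exists_nsmul_mem_range_of_one_tmul_mem_range`: `ℤ_ℓ` is flat over `ℤ`, so
  `1 ⊗ m = 0` in `ℤ_ℓ ⊗_ℤ M` forces `m` to be torsion, and `1 ⊗ x ∈ im (1 ⊗ L)` forces
  `n • x ∈ im L` for some integer `n ≥ 1` (descent of divisibility from `ℤ_ℓ ⊗_ℤ H` to `H` up to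
  torsion);
* `RationalTateModule.exists_smul_apply_eq_toRational`,
  `RationalTateModule.exists_linearMap_toRational_apply_eq_smul`: a `ℤ_ℓ`-linear map from a
  finitely generated `ℤ_ℓ`-module into `V_ℓ = ℚ_ℓ ⊗ T_ℓ` has bounded denominators, i.e. is
  `s⁻¹ • ι ∘ φ` for a map `φ` into the lattice `T_ℓ`, `s ∈ ℤ_ℓ ∖ {0}`, `ι : T_ℓ ↪ V_ℓ`;
* `exists_tateModule_pair_of_equiv` (**the lattice step**): for abelian varieties `A, B` over a
  field `K` with `T_ℓ A`, `T_ℓ B` finitely generated, an isomorphism `e : V_ℓ A ≅ V_ℓ B` of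
  `ℚ_ℓ[Γ_K]`-modules (Mathlib `Representation.Equiv` of `A.rationalTateRep ℓ`,
  `B.rationalTateRep ℓ`) yields `Γ_K`-equivariant `ℤ_ℓ`-linear `φ : T_ℓ A → T_ℓ B`,
  `ψ : T_ℓ B → T_ℓ A` and `c ≥ 0` with `ψ ∘ φ = ℓ^c = φ ∘ ψ`.

## Design notes

* Pure theorems: no definitions, no named facts (D-0026).
* The generic Tate-module statements are deliberate dot-notation extensions of
  `Literature.NumberTheory.EllipticCurves.RationalTateModule`, next to
  `RationalTateModule.exists_smul_eq_toRational` (`FaltingsECSemisimpleProofs`) and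
  `TateModule.toRational_injective` (`TateModuleFixedPointsProofs`), which they use; the
  `ℓ`-adic lemmas are prefixed `PadicInt.` as in `AVIsogenyTateInjectiveProofs`.
* Mathlib searched and used: `Submodule.le_of_le_smul_of_le_jacobson_bot` (Nakayama),
  `IsLocalRing.jacobson_eq_maximalIdeal`, `PadicInt.maximalIdeal_eq_span_p`,
  `OrzechProperty.injective_of_surjective_endomorphism`, the `Module.Flat` instance for
  torsion-free modules over a Dedekind domain (`RingTheory/Flat/TorsionFree`, with
  `IsAddTorsionFree ℤ_[ℓ]`), `Module.Flat.lTensor_preserves_injective_linearMap`,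
  `injective_zsmul_iff_not_isOfFinAddOrder`, `isOfFinAddOrder_iff_nsmul_eq_zero`,
  `LinearMap.range_mkQ_comp`, `Module.Finite.fg_top`, `Finset.dvd_prod_of_mem`,
  `PadicInt.unitCoeff_spec`, `Representation.Equiv` (`symm`, `symm_apply_apply`,
  `apply_symm_apply`, `IntertwiningMap.isIntertwining`). Mathlib has no Tate modules of abelian
  varieties and no form of the Tate/Faltings theorems.

## References

* [Faltings1983Endlichkeit] G. Faltings, *Endlichkeitssätze für abelsche Varietäten über
  Zahlkörpern*, Invent. Math. 73 (1983), 349–366, §5, Korollar 1 and Korollar 2; English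
  translation in Cornell–Silverman (eds.), *Arithmetic Geometry* (1986), Ch. II, §5, Corollary 2
  and its proof, read in the held copy (`book:cornellnd-arithmetic-geometry`, PDF p. 90).
* [Tate1966Endomorphisms] J. Tate, *Endomorphisms of abelian varieties over finite fields*,
  Invent. Math. 2 (1966), 134–144, §1 (lattices in `V_ℓ`, `Hom ⊗ ℤ_ℓ → Hom(T_ℓ, T_ℓ)`); not held,
  cited for the architecture of the argument only.
-/

noncomputable section

universe u

open scoped TensorProduct

namespace Literature.AlgebraicGeometry.Motives

/-! ## `ℓ`-adic linear algebra -/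

section PadicAlgebra

variable {ℓ : ℕ} [Fact ℓ.Prime]

/-- **`1 + ℓ u` is invertible on a finitely generated `ℤ_ℓ`-module.** For a finitely generated
`ℤ_ℓ`-module `M` and any `ℤ_ℓ`-linear `u : M → M`, the endomorphism `1 + ℓ • u` is bijective:
surjective by Nakayama's lemma (`M = (1 + ℓ u)(M) + ℓ M` and `ℓ` lies in the Jacobson radical of
the local ring `ℤ_ℓ`; Mathlib `Submodule.le_of_le_smul_of_le_jacobson_bot`), and a surjective
endomorphism of a finitely generated module over a commutative ring is injective (Vasconcelos;
Mathlib `OrzechProperty.injective_of_surjective_endomorphism`). [folklore] -/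
theorem PadicInt.bijective_id_add_p_smul {M : Type*} [AddCommGroup M] [Module ℤ_[ℓ] M]
    [Module.Finite ℤ_[ℓ] M] (u : M →ₗ[ℤ_[ℓ]] M) :
    Function.Bijective ((LinearMap.id : M →ₗ[ℤ_[ℓ]] M) + (ℓ : ℤ_[ℓ]) • u) := by
  set w : M →ₗ[ℤ_[ℓ]] M := LinearMap.id + (ℓ : ℤ_[ℓ]) • u with hw
  have hsurj : Function.Surjective w := by
    rw [← LinearMap.range_eq_top, eq_top_iff]
    refine Submodule.le_of_le_smul_of_le_jacobson_bot (I := IsLocalRing.maximalIdeal ℤ_[ℓ])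
      (N := LinearMap.range w) Module.Finite.fg_top ?_ ?_
    · rw [IsLocalRing.jacobson_eq_maximalIdeal ⊥ bot_ne_top]
    · intro m _
      have hm : m = w m - (ℓ : ℤ_[ℓ]) • u m := by
        simp [hw]
      rw [hm]
      refine Submodule.sub_mem _ (Submodule.mem_sup_left ⟨m, rfl⟩)
        (Submodule.mem_sup_right ?_)
      refine Submodule.smul_mem_smul ?_ Submodule.mem_top
      rw [PadicInt.maximalIdeal_eq_span_p]
      exact Ideal.mem_span_singleton_self _
  exact ⟨OrzechProperty.injective_of_surjective_endomorphism w hsurj, hsurj⟩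

/-- **Flat descent of vanishing from `ℤ_ℓ ⊗_ℤ M` to torsion in `M`.** If `m ∈ M` (an abelian
group) satisfies `1 ⊗ m = 0` in `ℤ_ℓ ⊗_ℤ M`, then `m` has finite order: otherwise `n ↦ n • m`
embeds `ℤ ↪ M`, and since `ℤ_ℓ` is torsion-free, hence flat, over `ℤ`
(Mathlib: a torsion-free module over a Dedekind domain is flat), `ℤ_ℓ = ℤ_ℓ ⊗ ℤ ↪ ℤ_ℓ ⊗ M`
would send `1` to `1 ⊗ m = 0`. [folklore] -/
theorem PadicInt.isOfFinAddOrder_of_one_tmul_eq_zero {M : Type*} [AddCommGroup M] {m : M}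
    (hm : (1 : ℤ_[ℓ]) ⊗ₜ[ℤ] m = 0) : IsOfFinAddOrder m := by
  by_contra h
  have hinj : Function.Injective (LinearMap.toSpanSingleton ℤ M m) := by
    intro a b hab
    exact (injective_zsmul_iff_not_isOfFinAddOrder.mpr h) hab
  have hflat : Function.Injective
      (LinearMap.lTensor ℤ_[ℓ] (LinearMap.toSpanSingleton ℤ M m)) :=
    Module.Flat.lTensor_preserves_injective_linearMap _ hinj
  have h1 : LinearMap.lTensor ℤ_[ℓ] (LinearMap.toSpanSingleton ℤ M m) ((1 : ℤ_[ℓ]) ⊗ₜ[ℤ] (1 : ℤ)) =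
      0 := by
    rw [LinearMap.lTensor_tmul, LinearMap.toSpanSingleton_apply, one_smul, hm]
  have h2 : (1 : ℤ_[ℓ]) ⊗ₜ[ℤ] (1 : ℤ) = 0 := hflat (h1.trans (map_zero _).symm)
  have h3 := congrArg (TensorProduct.rid ℤ ℤ_[ℓ]) h2
  rw [TensorProduct.rid_tmul, one_smul, map_zero] at h3
  exact one_ne_zero h3

/-- **Descent of divisibility along `ℤ → ℤ_ℓ`, up to torsion.** Let `L : H → H'` be a homomorphism
of abelian groups and `x ∈ H'`. If `1 ⊗ x` lies in the image of `1 ⊗ L : ℤ_ℓ ⊗ H → ℤ_ℓ ⊗ H'`,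
then `n • x` lies in the image of `L` for some integer `n ≥ 1`: in the cokernel `H' / L(H)` the
class of `x` satisfies `1 ⊗ [x] = 0` in `ℤ_ℓ ⊗ (H' / L(H))` (right exactness of `ℤ_ℓ ⊗ -`, in
the weak form `(1 ⊗ π) ∘ (1 ⊗ L) = 0`), hence has finite order
(`PadicInt.isOfFinAddOrder_of_one_tmul_eq_zero`). [folklore] -/
theorem PadicInt.exists_nsmul_mem_range_of_one_tmul_mem_range {H H' : Type*} [AddCommGroup H]
    [AddCommGroup H'] (L : H →ₗ[ℤ] H') {x : H'}
    (hx : (1 : ℤ_[ℓ]) ⊗ₜ[ℤ] x ∈ LinearMap.range (LinearMap.lTensor ℤ_[ℓ] L)) :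
    ∃ n : ℕ, 0 < n ∧ n • x ∈ LinearMap.range L := by
  obtain ⟨z, hz⟩ := hx
  have h0 : (1 : ℤ_[ℓ]) ⊗ₜ[ℤ] (LinearMap.range L).mkQ x = 0 := by
    have : LinearMap.lTensor ℤ_[ℓ] (LinearMap.range L).mkQ (LinearMap.lTensor ℤ_[ℓ] L z) = 0 := by
      rw [← LinearMap.comp_apply, ← LinearMap.lTensor_comp, LinearMap.range_mkQ_comp,
        LinearMap.lTensor_zero, LinearMap.zero_apply]
    rwa [hz, LinearMap.lTensor_tmul] at this
  obtain ⟨n, hn, hnx⟩ := (isOfFinAddOrder_iff_nsmul_eq_zero).mp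
    (PadicInt.isOfFinAddOrder_of_one_tmul_eq_zero h0)
  refine ⟨n, hn, ?_⟩
  rw [← Submodule.Quotient.mk_eq_zero, ← Submodule.mkQ_apply, map_nsmul]
  exact hnx

end PadicAlgebra

/-! ## Lattices in `V_ℓ = ℚ_ℓ ⊗ T_ℓ`: bounded denominators -/

section Lattice

open Literature.NumberTheory.EllipticCurves

variable (ℓ : ℕ) [Fact ℓ.Prime] {M : Type*} [AddCommGroup M]

/-- **A finitely generated family in `V_ℓ` has bounded denominators.** For a `ℤ_ℓ`-linear map
`g : N → V_ℓ M = ℚ_ℓ ⊗ T_ℓ M` on a finitely generated `ℤ_ℓ`-module `N` there is one non-zero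
`s ∈ ℤ_ℓ` with `s • g(x) ∈ T_ℓ M` (i.e. in the image of `ι : T_ℓ M ↪ V_ℓ M`,
`TateModule.toRational`) for all `x`: take the product of the denominators
(`RationalTateModule.exists_smul_eq_toRational`) of the images of finitely many generators.
(Tate 1966, §1: the image of a lattice under a `ℚ_ℓ`-linear map lies in `ℓ^{-c}` times a
lattice.) Deliberate dot-notation extension of
`Literature.NumberTheory.EllipticCurves.RationalTateModule` (generic Tate-module algebra).
[folklore] -/
theorem _root_.Literature.NumberTheory.EllipticCurves.RationalTateModule.exists_smul_apply_eq_toRational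
    {N : Type*} [AddCommGroup N] [Module ℤ_[ℓ] N] [Module.Finite ℤ_[ℓ] N]
    (g : N →ₗ[ℤ_[ℓ]] RationalTateModule M ℓ) :
    ∃ s : ℤ_[ℓ], s ≠ 0 ∧ ∀ x : N, ∃ t : TateModule M ℓ, s • g x = TateModule.toRational ℓ t := by
  obtain ⟨S, hS⟩ := Module.Finite.fg_top (R := ℤ_[ℓ]) (M := N)
  choose s hs t ht using fun x : N ↦ RationalTateModule.exists_smul_eq_toRational (g x)
  refine ⟨∏ x ∈ S, s x, Finset.prod_ne_zero_iff.mpr fun x _ ↦ hs x, fun x ↦ ?_⟩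
  have hx : x ∈ Submodule.span ℤ_[ℓ] (S : Set N) := by
    rw [hS]
    exact Submodule.mem_top
  induction hx using Submodule.span_induction with
  | mem y hy =>
    obtain ⟨r, hr⟩ := Finset.dvd_prod_of_mem s hy
    refine ⟨r • t y, ?_⟩
    rw [hr, mul_comm, mul_smul, ← algebraMap_smul ℚ_[ℓ] (s y), PadicInt.algebraMap_apply, ht y,
      LinearMap.map_smul]
  | zero => exact ⟨0, by rw [map_zero, smul_zero, map_zero]⟩
  | add y z _ _ hy hz =>
    obtain ⟨t₁, h₁⟩ := hy
    obtain ⟨t₂, h₂⟩ := hz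
    exact ⟨t₁ + t₂, by rw [map_add, smul_add, h₁, h₂, map_add]⟩
  | smul a y _ hy =>
    obtain ⟨t₁, h₁⟩ := hy
    exact ⟨a • t₁, by rw [LinearMap.map_smul, smul_comm, h₁, LinearMap.map_smul]⟩

/-- **Scaling a map into `V_ℓ` back into the lattice `T_ℓ`.** For `g : N → V_ℓ M` `ℤ_ℓ`-linear
with `N` finitely generated there are a non-zero `s ∈ ℤ_ℓ` and a `ℤ_ℓ`-linear `φ : N → T_ℓ M`
with `ι (φ x) = s • g x` for all `x` (bounded denominators,
`RationalTateModule.exists_smul_apply_eq_toRational`, and `ι : T_ℓ M ↪ V_ℓ M` injective,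
`TateModule.toRational_injective`). (Tate 1966, §1.) Deliberate dot-notation extension of
`Literature.NumberTheory.EllipticCurves.RationalTateModule`. [folklore] -/
theorem _root_.Literature.NumberTheory.EllipticCurves.RationalTateModule.exists_linearMap_toRational_apply_eq_smul
    {N : Type*} [AddCommGroup N] [Module ℤ_[ℓ] N] [Module.Finite ℤ_[ℓ] N]
    (g : N →ₗ[ℤ_[ℓ]] RationalTateModule M ℓ) :
    ∃ s : ℤ_[ℓ], s ≠ 0 ∧ ∃ φ : N →ₗ[ℤ_[ℓ]] TateModule M ℓ,
      ∀ x : N, TateModule.toRational ℓ (φ x) = s • g x := by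
  obtain ⟨s, hs, h⟩ := RationalTateModule.exists_smul_apply_eq_toRational ℓ g
  choose t ht using h
  have hι := TateModule.toRational_injective (A := M) (p := ℓ)
  refine ⟨s, hs, { toFun := t, map_add' := fun x y ↦ hι ?_, map_smul' := fun a x ↦ hι ?_ },
    fun x ↦ (ht x).symm⟩
  · simp only [map_add, ← ht, smul_add]
  · simp only [RingHom.id_apply, LinearMap.map_smul, ← ht]
    rw [smul_comm]

end Lattice

/-! ## From `V_ℓ A ≅ V_ℓ B` to a pair of `Γ_K`-maps `T_ℓ A ⇄ T_ℓ B` inverse up to `ℓ^c` -/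

section TatePair

open Literature.NumberTheory.EllipticCurves
open AbelianVariety

variable (ℓ : ℕ) [Fact ℓ.Prime]

variable {K : Type u} [Field K] {A B : AbelianVariety K}

/-- Unfolding the rational Tate representation on `T_ℓ A ↪ V_ℓ A`: `ρ_V(σ)(ι x) = ι (σ • x)`
(`V_ℓ A = ℚ_ℓ ⊗ T_ℓ A` with the base-changed action). [folklore] -/
theorem rationalTateRep_toRational (σ : Field.absoluteGaloisGroup K) (x : A.tateModule ℓ) :
    A.rationalTateRep ℓ σ (TateModule.toRational ℓ x) = TateModule.toRational ℓ (σ • x) :=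
  rfl

/-- **Equivariance descends from `V_ℓ` to `T_ℓ`.** If `φ : T_ℓ A → T_ℓ B` satisfies
`ι (φ x) = s • g x` for a `Γ_K`-equivariant `ℤ_ℓ`-linear `g : T_ℓ A → V_ℓ B`, then `φ` is
`Γ_K`-equivariant (`ι : T_ℓ B ↪ V_ℓ B` is an equivariant injection). [folklore] -/
theorem smul_apply_of_toRational_apply_eq {φ : A.tateModule ℓ →ₗ[ℤ_[ℓ]] B.tateModule ℓ}
    {g : A.tateModule ℓ →ₗ[ℤ_[ℓ]] B.rationalTateModule ℓ} {s : ℤ_[ℓ]}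
    (hφ : ∀ x, TateModule.toRational ℓ (φ x) = s • g x)
    (hg : ∀ (σ : Field.absoluteGaloisGroup K) (x : A.tateModule ℓ),
      g (σ • x) = B.rationalTateRep ℓ σ (g x))
    (σ : Field.absoluteGaloisGroup K) (x : A.tateModule ℓ) : φ (σ • x) = σ • φ x := by
  apply TateModule.toRational_injective (A := B.geomPoints) (p := ℓ)
  rw [hφ, hg, ← rationalTateRep_toRational, hφ, LinearMap.map_smul_of_tower]

variable [Module.Finite ℤ_[ℓ] (A.tateModule ℓ)] [Module.Finite ℤ_[ℓ] (B.tateModule ℓ)]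

/-- **Tate's lattice step** (Tate, Invent. Math. 2 (1966), §1; Faltings 1983, §5, proof of
Korollar 2). An isomorphism `e : V_ℓ A ≅ V_ℓ B` of `ℚ_ℓ[Γ_K]`-modules yields, when `T_ℓ A` and
`T_ℓ B` are finitely generated, `Γ_K`-equivariant `ℤ_ℓ`-linear maps `φ : T_ℓ A → T_ℓ B`,
`ψ : T_ℓ B → T_ℓ A` and `c ≥ 0` with `ψ ∘ φ = ℓ^c` and `φ ∘ ψ = ℓ^c`: scale `e|T_ℓ A` and
`e⁻¹|T_ℓ B` into the lattices (`RationalTateModule.exists_linearMap_toRational_apply_eq_smul`) and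
normalise the product of the two denominators to a power of `ℓ` by a unit of `ℤ_ℓ`
(Mathlib `PadicInt.unitCoeff_spec`). [cite: Faltings1983Endlichkeit, §5 Korollar 2] -/
theorem exists_tateModule_pair_of_equiv (e : (A.rationalTateRep ℓ).Equiv (B.rationalTateRep ℓ)) :
    ∃ (c : ℕ) (φ : A.tateModule ℓ →ₗ[ℤ_[ℓ]] B.tateModule ℓ)
      (ψ : B.tateModule ℓ →ₗ[ℤ_[ℓ]] A.tateModule ℓ),
      (∀ (σ : Field.absoluteGaloisGroup K) (x : A.tateModule ℓ), φ (σ • x) = σ • φ x) ∧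
      (∀ (σ : Field.absoluteGaloisGroup K) (y : B.tateModule ℓ), ψ (σ • y) = σ • ψ y) ∧
      ψ ∘ₗ φ = ((ℓ : ℤ_[ℓ]) ^ c) • LinearMap.id ∧ φ ∘ₗ ψ = ((ℓ : ℤ_[ℓ]) ^ c) • LinearMap.id := by
  -- `e` and `e⁻¹` restricted to the lattices, as `ℤ_ℓ`-linear maps into `V_ℓ`
  let gA : A.tateModule ℓ →ₗ[ℤ_[ℓ]] B.rationalTateModule ℓ :=
    (e.toLinearEquiv.toLinearMap.restrictScalars ℤ_[ℓ]) ∘ₗ TateModule.toRational ℓ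
  let gB : B.tateModule ℓ →ₗ[ℤ_[ℓ]] A.rationalTateModule ℓ :=
    (e.symm.toLinearEquiv.toLinearMap.restrictScalars ℤ_[ℓ]) ∘ₗ TateModule.toRational ℓ
  have hgA : ∀ x, gA x = e (TateModule.toRational ℓ x) := fun x ↦ rfl
  have hgB : ∀ y, gB y = e.symm (TateModule.toRational ℓ y) := fun y ↦ rfl
  have heq : ∀ (σ : Field.absoluteGaloisGroup K) (v : A.rationalTateModule ℓ),
      e (A.rationalTateRep ℓ σ v) = B.rationalTateRep ℓ σ (e v) :=
    fun σ v ↦ e.toIntertwiningMap.isIntertwining _ _ σ v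
  have heq' : ∀ (σ : Field.absoluteGaloisGroup K) (w : B.rationalTateModule ℓ),
      e.symm (B.rationalTateRep ℓ σ w) = A.rationalTateRep ℓ σ (e.symm w) :=
    fun σ w ↦ e.symm.toIntertwiningMap.isIntertwining _ _ σ w
  obtain ⟨s₁, hs₁, φ, hφ⟩ := RationalTateModule.exists_linearMap_toRational_apply_eq_smul ℓ gA
  obtain ⟨s₂, hs₂, ψ, hψ⟩ := RationalTateModule.exists_linearMap_toRational_apply_eq_smul ℓ gB
  -- normalise `s₁ s₂ = u ℓ^c`
  have hs : s₁ * s₂ ≠ 0 := mul_ne_zero hs₁ hs₂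
  have hspec := PadicInt.unitCoeff_spec hs
  set u : ℤ_[ℓ]ˣ := PadicInt.unitCoeff hs
  set c : ℕ := (s₁ * s₂).valuation
  have hu : ((u⁻¹ : ℤ_[ℓ]ˣ) : ℤ_[ℓ]) * (s₁ * s₂) = (ℓ : ℤ_[ℓ]) ^ c :=
    (congrArg (fun z : ℤ_[ℓ] ↦ ((u⁻¹ : ℤ_[ℓ]ˣ) : ℤ_[ℓ]) * z) hspec).trans
      (Units.inv_mul_cancel_left u _)
  -- `ℚ_ℓ`-scalar forms of `hφ`, `hψ`
  have hφ' : ∀ x, TateModule.toRational ℓ (φ x) =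
      algebraMap ℤ_[ℓ] ℚ_[ℓ] s₁ • e (TateModule.toRational ℓ x) := fun x ↦ by
    rw [algebraMap_smul, ← hgA, ← hφ x]
  have hψ' : ∀ y, TateModule.toRational ℓ (ψ y) =
      algebraMap ℤ_[ℓ] ℚ_[ℓ] s₂ • e.symm (TateModule.toRational ℓ y) := fun y ↦ by
    rw [algebraMap_smul, ← hgB, ← hψ y]
  refine ⟨c, φ, ((u⁻¹ : ℤ_[ℓ]ˣ) : ℤ_[ℓ]) • ψ, ?_, ?_, ?_, ?_⟩
  · refine smul_apply_of_toRational_apply_eq ℓ hφ fun σ x ↦ ?_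
    rw [hgA, hgA, ← rationalTateRep_toRational]
    exact heq σ _
  · intro σ y
    have hψσ : ψ (σ • y) = σ • ψ y := by
      refine smul_apply_of_toRational_apply_eq ℓ hψ (fun σ y ↦ ?_) σ y
      rw [hgB, hgB, ← rationalTateRep_toRational]
      exact heq' σ _
    rw [LinearMap.smul_apply, LinearMap.smul_apply, hψσ]
    exact (smul_comm σ _ _).symm
  · refine LinearMap.ext fun x ↦ TateModule.toRational_injective (A := A.geomPoints) (p := ℓ) ?_
    rw [LinearMap.comp_apply, LinearMap.smul_apply, LinearMap.map_smul, hψ', hφ', map_smul,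
      e.symm_apply_apply, LinearMap.smul_apply, LinearMap.id_apply, LinearMap.map_smul,
      smul_smul, ← map_mul, algebraMap_smul, smul_smul, mul_comm s₂ s₁, hu]
  · refine LinearMap.ext fun y ↦ TateModule.toRational_injective (A := B.geomPoints) (p := ℓ) ?_
    rw [LinearMap.comp_apply, LinearMap.smul_apply, LinearMap.map_smul_of_tower,
      LinearMap.map_smul, hφ', hψ', map_smul, e.apply_symm_apply, LinearMap.smul_apply,
      LinearMap.id_apply, LinearMap.map_smul, smul_smul, ← map_mul, algebraMap_smul, smul_smul, hu]

end TatePair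

end Literature.AlgebraicGeometry.Motives
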